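import Literature.NumberTheory.Weil1965.AdelicSiegelFunctionalCutoffContinuity
import Literature.NumberTheory.Weil1965.AdelicSiegelFunctionalComplex
import Literature.Analysis.Distribution.SchwartzEnvelope
import HarnessLib

/-!
# Weil's `E_X` IS its measure on all of `𝒮(𝔸_F^m)`: `Σ_ξ F*_Φ(ξ) = ∫ Φ dE_X = Σ_b ∫ Φ dμ_b` for every `Φ ∈ 𝒮`

Topic `NumberTheory/Weil1965`; namespace `Literature.NumberTheory.Weil1965`.  KERNEL mathematics only (theorems; no definition,
no named fact, no `axiom`, no `sorry`).  Sequel of ★ `AdelicSiegelFunctionalCutoffContinuity` (`∫ Ψ dν_E = E_X(Ψ)` for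
`0 ≤ Ψ ∈ 𝒮_ℝ`), ★ `AdelicFibreMeasures` (`ν_E = Σ_b μ_b`, `integral_adelicSiegelMeasure_eq_tsum`) and ★ `AdelicSiegelFunctionalComplex`
(`Σ_ξ F*_Φ(ξ) = E_X(Re Φ) + i E_X(Im Φ)`).

* §1 **domination in `𝒮_ℝ`**: every `Ψ ∈ 𝒮_ℝ(𝔸_F^ι)` (indeed every `Φ ∈ 𝒮(𝔸_F^ι)`) is dominated by a NON-NEGATIVE `Θ ∈ 𝒮_ℝ(𝔸_F^ι)`,
  `|Ψ| ≤ Θ` (`exists_piSchwartzBruhatReal_nonneg_norm_le`, `exists_piSchwartzBruhatReal_nonneg_abs_le`: a Schwartz envelope of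
  `|Φ_∞|`, ★ B-p12 `SchwartzEnvelope.exists_schwartz_complex_ge_of_rapid_decay`, tensored with `M·𝟙_K` on the compact open support of
  the finite part; span induction);
* §2 **GENERIC**: a positive functional `S` on `𝒮_ℝ` with `∫ Ψ dν_S = S Ψ` for all `Ψ ≥ 0` has `Ψ ∈ L¹(ν_S)` and `∫ Ψ dν_S = S Ψ` for
  ALL `Ψ ∈ 𝒮_ℝ` (`Ψ = (Ψ + Θ) − Θ`; `integral_schwartzBruhatMeasure_eq_of_forall_nonneg`) — serves the theta side (★
  `integral_schwartzBruhatMeasure_thetaOrbitFunctionalReal_eq`) as well;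
* §3 **THE EISENSTEIN SIDE for `h = q_S`** (`F` totally real, `S ∈ Sym_m(F)`, `det S ≠ 0`, `4 < m`): for every `Ψ ∈ 𝒮_ℝ(𝔸_F^m)`,
  `Ψ ∈ L¹(ν_E)` and `∫ Ψ dν_E = E_X(Ψ) = Σ_b ∫ Ψ dμ_b` (`integral_adelicSiegelMeasure_sdForm_eq_of_mem`,
  `adelicSiegelFunctional_sdForm_eq_tsum_integral_fibre`); and for every complex `Φ ∈ 𝒮(𝔸_F^m)`, `Φ ∈ L¹(ν_E)`,
  **`Σ'_{ξ ∈ F} F*_Φ(ξ) = ∫ Φ dν_E = Σ'_{b ∈ F} ∫ Φ dμ_b`** with `HasSum` (`tsum_adelicSiegelCoeff_sdForm_eq_integral`,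
  `hasSum_integral_adelicSiegelFibreMeasure_sdForm`, `tsum_adelicSiegelCoeff_sdForm_eq_tsum_integral_fibre`) — Weil's (35)
  "`E_X = Σ μ_b`" as an identity of tempered distributions on ALL test functions: the letter (E-DEC) of the Siegel–Weil closing sheet
  modulo the unfolding `E(Φ) = Φ(0) + Σ_β F*_Φ(β)` of the Eisenstein series.

Cell `hodgecm-mathlib`, FLOOR 0, crux H413 (stmt-HodgeConjecture-24833), E-2 ∕ SW2 road (W), row «E-DEC glue» (F0P4-p06 (g3)).  HC_CM is
proved only modulo the printed citations until rung 0 closes; this file is unconditional.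

## References
* [Weil1965] A. Weil, *Sur la formule de Siegel dans la théorie des groupes classiques*, Acta Math. 113 (1965): Chap. I n° 2,
  Lemmes 2–5, pp. 7–10; Chap. IV n° 41 (34)–(35), p. 59.
* [HormanderALPDO1] L. Hörmander, *The Analysis of Linear Partial Differential Operators I*, 2nd ed. (1990), §7.1.
-/

set_option autoImplicit false

noncomputable section

open MeasureTheory Filter Topology Set NumberField NumberField.InfinitePlace NumberField.mixedEmbedding IsDedekindDomain
open scoped NNReal ENNReal Matrix Classical SchwartzMap
open Literature.NumberTheory.Automorphic Literature.NumberTheory.Weil1964 Literature.Analysis.Distribution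

namespace Literature.NumberTheory.Weil1965

/-! ## §1 Every Schwartz–Bruhat function is dominated by a non-negative real Schwartz–Bruhat function -/

section Domination

variable (K : Type) [Field K] [NumberField K] (ι : Type) [Fintype ι]

omit [Fintype ι] in
/-- `(𝔸_K^∞)^ι` is Hausdorff. [folklore] -/
private theorem t2Space_piFinAdele' : T2Space (ι → FiniteAdeleRing (𝓞 K) K) := by
  haveI : T2Space (FiniteAdeleRing (𝓞 K) K) := inferInstanceAs <| T2Space
    (RestrictedProduct (fun w : HeightOneSpectrum (𝓞 K) => w.adicCompletion K)
      (fun w => (w.adicCompletionIntegers K : Set (w.adicCompletion K))) Filter.cofinite)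
  infer_instance

variable {K ι}

omit [Fintype ι] in
/-- a locally constant compactly supported `Φ_f` on `(𝔸_K^∞)^ι` is bounded by `M · 𝟙_K` with `K` its (compact open) support and
`M ≥ 0`. [folklore] -/
private theorem exists_norm_le_indicator_of_mem_schwartzBruhat {Φfin : (ι → FiniteAdeleRing (𝓞 K) K) → ℂ}
    (hfin : Φfin ∈ SchwartzBruhat (ι → FiniteAdeleRing (𝓞 K) K)) :
    ∃ (U : Set (ι → FiniteAdeleRing (𝓞 K) K)) (M : ℝ), IsClopen U ∧ IsCompact U ∧ 0 ≤ M ∧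
      ∀ z, ‖Φfin z‖ ≤ M * U.indicator (1 : (ι → FiniteAdeleRing (𝓞 K) K) → ℝ) z := by
  obtain ⟨hlc, hcs⟩ := (mem_schwartzBruhat_iff).1 hfin
  -- the support is the complement of the (clopen) zero fibre
  have hU : IsClopen (Function.support Φfin) := by
    have h := (hlc.isClopen_fiber (0 : ℂ)).compl
    convert h using 1
    ext z
    simp only [Function.mem_support, ne_eq, mem_compl_iff, mem_setOf_eq]
  have hUc : IsCompact (Function.support Φfin) := by
    have h : tsupport Φfin = Function.support Φfin := hU.isClosed.closure_eq
    rw [← h]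
    exact hcs
  obtain ⟨C, hC⟩ := hlc.continuous.bounded_above_of_compact_support hcs
  refine ⟨Function.support Φfin, max C 0, hU, hUc, le_max_right _ _, fun z => ?_⟩
  by_cases hz : z ∈ Function.support Φfin
  · rw [indicator_of_mem hz, Pi.one_apply, mul_one]
    exact (hC z).trans (le_max_left _ _)
  · rw [Function.mem_support, not_not] at hz
    rw [hz, norm_zero]
    exact mul_nonneg (le_max_right _ _) (indicator_nonneg (fun _ _ => zero_le_one) _)

/-- **Every `Φ ∈ 𝒮(𝔸_K^ι)` is dominated by a non-negative REAL Schwartz–Bruhat function**: `‖Φ‖ ≤ Θ`, `0 ≤ Θ ∈ 𝒮_ℝ(𝔸_K^ι)`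
(for a pure tensor: a Schwartz envelope of `|Φ_∞|` tensored with `M·𝟙_K`, `K` the compact open support of `Φ_f`; pure tensors span).
[cite: Weil1965, Chap. I n° 2, Lemme 3, p. 7] [cite: HormanderALPDO1, §7.1] -/
theorem exists_piSchwartzBruhatReal_nonneg_norm_le {Φ : (ι → AdeleRing (𝓞 K) K) → ℂ} (hΦ : Φ ∈ piSchwartzBruhat K ι) :
    ∃ Θ : piSchwartzBruhatReal K ι, (∀ v, 0 ≤ (Θ : (ι → AdeleRing (𝓞 K) K) → ℝ) v) ∧
      ∀ v, ‖Φ v‖ ≤ (Θ : (ι → AdeleRing (𝓞 K) K) → ℝ) v := by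
  haveI : T2Space (ι → FiniteAdeleRing (𝓞 K) K) := t2Space_piFinAdele' K ι
  induction hΦ using Submodule.span_induction with
  | mem Ψ hΨ =>
    obtain ⟨Φinf, Φfin, hfin, rfl⟩ := hΨ
    -- archimedean envelope
    have hdecay : ∀ N : ℕ, ∃ C : ℝ, ∀ y : ι → mixedSpace K, |‖Φinf y‖| * (1 + ‖y‖) ^ N ≤ C := fun N => by
      refine ⟨2 ^ N * (Finset.Iic (N, 0)).sup (schwartzSeminormFamily ℂ (ι → mixedSpace K) ℂ) Φinf, fun y => ?_⟩
      have h := SchwartzMap.one_add_le_sup_seminorm_apply (𝕜 := ℂ) (m := (N, 0)) (k := N) (n := 0) le_rfl le_rfl Φinf y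
      rw [norm_iteratedFDeriv_zero] at h
      rwa [abs_of_nonneg (norm_nonneg _), mul_comm]
    obtain ⟨G, hG0, hG⟩ := exists_schwartz_complex_ge_of_rapid_decay hdecay
    -- finite bound
    obtain ⟨U, M, hU, hUc, hM0, hM⟩ := exists_norm_le_indicator_of_mem_schwartzBruhat hfin
    -- the dominating tensor `G ⊗ (M 𝟙_U)`
    have hGfin : (fun z => (M : ℂ) * U.indicator (fun _ => (1 : ℂ)) z) ∈ SchwartzBruhat (ι → FiniteAdeleRing (𝓞 K) K) :=
      (SchwartzBruhat _).smul_mem (M : ℂ) (indicator_one_mem_schwartzBruhat hU hUc)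
    have hmem : (fun v => G (piArch K ι v) * ((M : ℂ) * U.indicator (fun _ => (1 : ℂ)) (piFinite K ι v))) ∈
        piSchwartzBruhat K ι := tensor_mem_piSchwartzBruhat G hGfin
    set Θ : (ι → AdeleRing (𝓞 K) K) → ℝ := fun v => (G (piArch K ι v)).re * (M * U.indicator 1 (piFinite K ι v)) with hΘ
    have hΘc : (fun v => (Θ v : ℂ)) = fun v => G (piArch K ι v) * ((M : ℂ) * U.indicator (fun _ => (1 : ℂ)) (piFinite K ι v)) := by
      funext v
      have hGre : ((G (piArch K ι v)).re : ℂ) = G (piArch K ι v) :=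
        Complex.ext (by simp) (by simp [(hG0 (piArch K ι v)).1])
      simp only [hΘ, Complex.ofReal_mul, hGre]
      congr 1
      by_cases hz : piFinite K ι v ∈ U
      · simp [indicator_of_mem hz]
      · simp [indicator_of_notMem hz]
    have hΘmem : Θ ∈ piSchwartzBruhatReal K ι := by
      rw [mem_piSchwartzBruhatReal_iff, hΘc]
      exact hmem
    refine ⟨⟨Θ, hΘmem⟩, fun v => ?_, fun v => ?_⟩
    · exact mul_nonneg (hG0 _).2 (mul_nonneg hM0 (indicator_nonneg (fun _ _ => zero_le_one) _))
    · show ‖Φinf (piArch K ι v) * Φfin (piFinite K ι v)‖ ≤ Θ v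
      rw [norm_mul]
      have h1 : ‖Φinf (piArch K ι v)‖ ≤ (G (piArch K ι v)).re := by
        have := hG (piArch K ι v)
        rwa [abs_of_nonneg (norm_nonneg _)] at this
      exact mul_le_mul h1 (hM _) (norm_nonneg _) (hG0 _).2
  | zero => exact ⟨0, fun v => le_rfl, fun v => by simp⟩
  | add Ψ₁ Ψ₂ _ _ h₁ h₂ =>
    obtain ⟨Θ₁, h₁0, h₁le⟩ := h₁
    obtain ⟨Θ₂, h₂0, h₂le⟩ := h₂
    refine ⟨Θ₁ + Θ₂, fun v => ?_, fun v => ?_⟩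
    · simp only [Submodule.coe_add, Pi.add_apply]
      exact add_nonneg (h₁0 v) (h₂0 v)
    · simp only [Submodule.coe_add, Pi.add_apply]
      exact (norm_add_le _ _).trans (add_le_add (h₁le v) (h₂le v))
  | smul a Ψ _ h =>
    obtain ⟨Θ, h0, hle⟩ := h
    refine ⟨‖a‖ • Θ, fun v => ?_, fun v => ?_⟩
    · simp only [Submodule.coe_smul, Pi.smul_apply, smul_eq_mul]
      exact mul_nonneg (norm_nonneg _) (h0 v)
    · simp only [Submodule.coe_smul, Pi.smul_apply, smul_eq_mul, norm_mul]
      exact mul_le_mul_of_nonneg_left (hle v) (norm_nonneg _)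

/-- **Every `Ψ ∈ 𝒮_ℝ(𝔸_K^ι)` is dominated by a non-negative `Θ ∈ 𝒮_ℝ(𝔸_K^ι)`: `|Ψ| ≤ Θ`.**
[cite: Weil1965, Chap. I n° 2, Lemme 3, p. 7] [cite: HormanderALPDO1, §7.1] -/
theorem exists_piSchwartzBruhatReal_nonneg_abs_le (Ψ : piSchwartzBruhatReal K ι) :
    ∃ Θ : piSchwartzBruhatReal K ι, (0 ≤ (Θ : (ι → AdeleRing (𝓞 K) K) → ℝ)) ∧
      ∀ v, |(Ψ : (ι → AdeleRing (𝓞 K) K) → ℝ) v| ≤ (Θ : (ι → AdeleRing (𝓞 K) K) → ℝ) v := by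
  have hΨ := Ψ.2
  rw [mem_piSchwartzBruhatReal_iff] at hΨ
  obtain ⟨Θ, h0, hle⟩ := exists_piSchwartzBruhatReal_nonneg_norm_le hΨ
  exact ⟨Θ, fun v => h0 v, fun v => by simpa only [Complex.norm_real, Real.norm_eq_abs] using hle v⟩

end Domination

/-! ## §2 A positive functional that is its measure on `Ψ ≥ 0` is its measure on all of `𝒮_ℝ` -/

section Generic

variable (F : Type) [Field F] [NumberField F] (ι : Type) [Fintype ι]
  [MeasurableSpace (AdeleRing (𝓞 F) F)] [BorelSpace (AdeleRing (𝓞 F) F)]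
  (S : piSchwartzBruhatReal F ι →ₗ[ℝ] ℝ)
  (hS : ∀ Ψ : piSchwartzBruhatReal F ι, 0 ≤ (Ψ : (ι → AdeleRing (𝓞 F) F) → ℝ) → 0 ≤ S Ψ)

/-- **FROM `Ψ ≥ 0` TO ALL `Ψ`**: if `∫ Ψ dν_S = S Ψ` (with integrability) for every non-negative `Ψ ∈ 𝒮_ℝ(X)`, then every
`Ψ ∈ 𝒮_ℝ(X)` is `ν_S`-integrable with `∫ Ψ dν_S = S Ψ` — write `Ψ = (Ψ + Θ) − Θ` with `Θ ≥ |Ψ|` in `𝒮_ℝ(X)`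
(`exists_piSchwartzBruhatReal_nonneg_abs_le`). [cite: Weil1965, Chap. I n° 2, Lemmes 2–3, p. 7] -/
theorem integral_schwartzBruhatMeasure_eq_of_forall_nonneg
    (h : ∀ Ψ : piSchwartzBruhatReal F ι, 0 ≤ (Ψ : (ι → AdeleRing (𝓞 F) F) → ℝ) →
      Integrable (Ψ : (ι → AdeleRing (𝓞 F) F) → ℝ) (schwartzBruhatMeasure F ι S hS) ∧
        ∫ x, (Ψ : (ι → AdeleRing (𝓞 F) F) → ℝ) x ∂(schwartzBruhatMeasure F ι S hS) = S Ψ)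
    (Ψ : piSchwartzBruhatReal F ι) :
    Integrable (Ψ : (ι → AdeleRing (𝓞 F) F) → ℝ) (schwartzBruhatMeasure F ι S hS) ∧
      ∫ x, (Ψ : (ι → AdeleRing (𝓞 F) F) → ℝ) x ∂(schwartzBruhatMeasure F ι S hS) = S Ψ := by
  obtain ⟨Θ, hΘ0, hΘ⟩ := exists_piSchwartzBruhatReal_nonneg_abs_le Ψ
  have hpos : 0 ≤ ((Ψ + Θ : piSchwartzBruhatReal F ι) : (ι → AdeleRing (𝓞 F) F) → ℝ) := fun v => by
    simp only [Submodule.coe_add, Pi.add_apply, Pi.zero_apply]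
    have := hΘ v
    have := neg_abs_le ((Ψ : (ι → AdeleRing (𝓞 F) F) → ℝ) v)
    linarith
  obtain ⟨hi₁, he₁⟩ := h (Ψ + Θ) hpos
  obtain ⟨hi₂, he₂⟩ := h Θ hΘ0
  have hfun : ((Ψ : piSchwartzBruhatReal F ι) : (ι → AdeleRing (𝓞 F) F) → ℝ) =
      ((Ψ + Θ : piSchwartzBruhatReal F ι) : (ι → AdeleRing (𝓞 F) F) → ℝ) - ((Θ : piSchwartzBruhatReal F ι) : (ι → AdeleRing (𝓞 F) F) → ℝ) := by
    simp only [Submodule.coe_add, add_sub_cancel_right]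
  have hint : Integrable (Ψ : (ι → AdeleRing (𝓞 F) F) → ℝ) (schwartzBruhatMeasure F ι S hS) := by
    rw [hfun]
    exact hi₁.sub hi₂
  refine ⟨hint, ?_⟩
  rw [hfun, Pi.sub_def, integral_sub hi₁ hi₂, he₁, he₂, ← map_sub, add_sub_cancel_right]

end Generic

/-! ## §3 The Eisenstein side for `h = q_S`: `Σ_ξ F*_Φ(ξ) = ∫ Φ dE_X = Σ_b ∫ Φ dμ_b` for every `Φ ∈ 𝒮(𝔸_F^m)` -/

section Eisenstein

variable (F : Type) [Field F] [NumberField F] [IsTotallyReal F] {m : ℕ}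
  [MeasurableSpace (adeleQuotient F)] [BorelSpace (adeleQuotient F)]
  [MeasurableSpace (AdeleRing (𝓞 F) F)] [BorelSpace (AdeleRing (𝓞 F) F)]
  (μ : Measure (Fin m → AdeleRing (𝓞 F) F)) [μ.IsAddHaarMeasure] (hm : 4 < m)
  {S : Matrix (Fin m) (Fin m) F} (hS : S.IsSymm) (hdet : S.det ≠ 0)
  (hh : Continuous fun x : Fin m → AdeleRing (𝓞 F) F => sdForm F (ratMatrix F S) x)
  (hB : ∀ Φ ∈ piSchwartzBruhat F (Fin m), Summable fun ξ : F =>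
    ‖adelicSiegelCoeff F (Fin m) μ (fun x => sdForm F (ratMatrix F S) x) Φ ξ‖)

include hm hS hdet in
/-- **`E_X` IS ITS MEASURE ON ALL OF `𝒮_ℝ`** (`h = q_S`, `F` totally real, `S` symmetric, `det S ≠ 0`, `4 < m`): every
`Ψ ∈ 𝒮_ℝ(𝔸_F^m)` is `ν_E`-integrable and `∫ Ψ dν_E = E_X(Ψ)`. [cite: Weil1965, Chap. IV n° 41, (35) p. 59; Chap. I n° 2, Lemmes 2–3] -/
theorem integral_adelicSiegelMeasure_sdForm_eq_of_mem (Ψ : piSchwartzBruhatReal F (Fin m)) :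
    Integrable (Ψ : (Fin m → AdeleRing (𝓞 F) F) → ℝ)
        (adelicSiegelMeasure F (Fin m) μ (fun x => sdForm F (ratMatrix F S) x) hh hB) ∧
      ∫ x, (Ψ : (Fin m → AdeleRing (𝓞 F) F) → ℝ) x ∂(adelicSiegelMeasure F (Fin m) μ (fun x => sdForm F (ratMatrix F S) x) hh hB) =
        adelicSiegelFunctional F (Fin m) μ (fun x => sdForm F (ratMatrix F S) x) hh hB Ψ := by
  obtain ⟨c, hcS, -, -, -, -, -, hall⟩ := exists_cutoff_tendsto_adelicSiegelFunctional_sdForm F μ hm hS hdet hh hB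
  exact integral_schwartzBruhatMeasure_eq_of_forall_nonneg F (Fin m) _ _ hall Ψ

include hm hS hdet in
/-- **`E_X(Ψ) = Σ_b ∫ Ψ dμ_b` for every `Ψ ∈ 𝒮_ℝ(𝔸_F^m)`** (with `HasSum`), `μ_b = adelicSiegelFibreMeasure … b` the fibre measures.
[cite: Weil1965, Chap. IV n° 41, (35) p. 59] -/
theorem hasSum_integral_adelicSiegelFibreMeasure_sdForm_real (Ψ : piSchwartzBruhatReal F (Fin m)) :
    HasSum (fun b : F => ∫ x, (Ψ : (Fin m → AdeleRing (𝓞 F) F) → ℝ) x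
        ∂(adelicSiegelFibreMeasure F (Fin m) μ (fun x => sdForm F (ratMatrix F S) x) hh hB b))
      (adelicSiegelFunctional F (Fin m) μ (fun x => sdForm F (ratMatrix F S) x) hh hB Ψ) := by
  obtain ⟨hint, heq⟩ := integral_adelicSiegelMeasure_sdForm_eq_of_mem F μ hm hS hdet hh hB Ψ
  rw [← heq, ← sum_adelicSiegelFibreMeasure]
  rw [← sum_adelicSiegelFibreMeasure] at hint
  exact hasSum_integral_measure hint

include hm hS hdet in
/-- **Every complex `Φ ∈ 𝒮(𝔸_F^m)` is `ν_E`-integrable and `Σ'_{ξ ∈ F} F*_Φ(ξ) = ∫ Φ dν_E`** (real and imaginary parts,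
★ `tsum_adelicSiegelCoeff_eq_re_add_im`). [cite: Weil1965, Chap. IV n° 41, (34)–(35) p. 59] -/
theorem tsum_adelicSiegelCoeff_sdForm_eq_integral {Φ : (Fin m → AdeleRing (𝓞 F) F) → ℂ}
    (hΦ : Φ ∈ piSchwartzBruhat F (Fin m)) :
    Integrable Φ (adelicSiegelMeasure F (Fin m) μ (fun x => sdForm F (ratMatrix F S) x) hh hB) ∧
      ∑' ξ : F, adelicSiegelCoeff F (Fin m) μ (fun x => sdForm F (ratMatrix F S) x) Φ ξ =
        ∫ x, Φ x ∂(adelicSiegelMeasure F (Fin m) μ (fun x => sdForm F (ratMatrix F S) x) hh hB) := by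
  obtain ⟨hre, hre_eq⟩ := integral_adelicSiegelMeasure_sdForm_eq_of_mem F μ hm hS hdet hh hB
    ⟨fun v => (Φ v).re, re_mem_piSchwartzBruhatReal hΦ⟩
  obtain ⟨him, him_eq⟩ := integral_adelicSiegelMeasure_sdForm_eq_of_mem F μ hm hS hdet hh hB
    ⟨fun v => (Φ v).im, im_mem_piSchwartzBruhatReal hΦ⟩
  have hint : Integrable Φ (adelicSiegelMeasure F (Fin m) μ (fun x => sdForm F (ratMatrix F S) x) hh hB) :=
    (Integrable.re_im_iff (𝕜 := ℂ) (f := Φ)).1 ⟨hre, him⟩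
  refine ⟨hint, ?_⟩
  rw [tsum_adelicSiegelCoeff_eq_re_add_im F (Fin m) hh hB hΦ, ← integral_re_add_im hint]
  simp only [RCLike.re_to_complex, RCLike.im_to_complex, RCLike.I_to_complex]
  have h1 : ∫ x, (Φ x).re ∂(adelicSiegelMeasure F (Fin m) μ (fun x => sdForm F (ratMatrix F S) x) hh hB) =
      adelicSiegelFunctional F (Fin m) μ (fun x => sdForm F (ratMatrix F S) x) hh hB
        ⟨fun v => (Φ v).re, re_mem_piSchwartzBruhatReal hΦ⟩ := hre_eq
  have h2 : ∫ x, (Φ x).im ∂(adelicSiegelMeasure F (Fin m) μ (fun x => sdForm F (ratMatrix F S) x) hh hB) =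
      adelicSiegelFunctional F (Fin m) μ (fun x => sdForm F (ratMatrix F S) x) hh hB
        ⟨fun v => (Φ v).im, im_mem_piSchwartzBruhatReal hΦ⟩ := him_eq
  rw [h1, h2, mul_comm]
  rfl

include hm hS hdet in
/-- **`∫ Φ dν_E = Σ_b ∫ Φ dμ_b` with `HasSum`, for every complex `Φ ∈ 𝒮(𝔸_F^m)`** (`ν_E = Σ_b μ_b`, ★ `sum_adelicSiegelFibreMeasure`).
[cite: Weil1965, Chap. IV n° 41, (35) p. 59] -/
theorem hasSum_integral_adelicSiegelFibreMeasure_sdForm {Φ : (Fin m → AdeleRing (𝓞 F) F) → ℂ}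
    (hΦ : Φ ∈ piSchwartzBruhat F (Fin m)) :
    HasSum (fun b : F => ∫ x, Φ x ∂(adelicSiegelFibreMeasure F (Fin m) μ (fun x => sdForm F (ratMatrix F S) x) hh hB b))
      (∫ x, Φ x ∂(adelicSiegelMeasure F (Fin m) μ (fun x => sdForm F (ratMatrix F S) x) hh hB)) := by
  have hint := (tsum_adelicSiegelCoeff_sdForm_eq_integral F μ hm hS hdet hh hB hΦ).1
  rw [← sum_adelicSiegelFibreMeasure] at hint ⊢
  exact hasSum_integral_measure hint

include hm hS hdet in
/-- **WEIL'S `E_X = Σ_b μ_b` ON ALL TEST FUNCTIONS**: for every complex `Φ ∈ 𝒮(𝔸_F^m)` (`h = q_S`, `F` totally real, `S` symmetric,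
`det S ≠ 0`, `4 < m`), `Σ'_{ξ ∈ F} F*_Φ(ξ) = Σ'_{b ∈ F} ∫ Φ dμ_b` — the letter (E-DEC) of the Siegel–Weil closing step modulo the
unfolding of the Eisenstein series. [cite: Weil1965, Chap. IV n° 41, (34)–(35) p. 59] -/
theorem tsum_adelicSiegelCoeff_sdForm_eq_tsum_integral_fibre {Φ : (Fin m → AdeleRing (𝓞 F) F) → ℂ}
    (hΦ : Φ ∈ piSchwartzBruhat F (Fin m)) :
    ∑' ξ : F, adelicSiegelCoeff F (Fin m) μ (fun x => sdForm F (ratMatrix F S) x) Φ ξ =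
      ∑' b : F, ∫ x, Φ x ∂(adelicSiegelFibreMeasure F (Fin m) μ (fun x => sdForm F (ratMatrix F S) x) hh hB b) := by
  rw [(tsum_adelicSiegelCoeff_sdForm_eq_integral F μ hm hS hdet hh hB hΦ).2,
    (hasSum_integral_adelicSiegelFibreMeasure_sdForm F μ hm hS hdet hh hB hΦ).tsum_eq]

include hm hS hdet in
/-- **Raw chirp currency**: `Σ'_{ξ ∈ F} ∫ chirp(ξ•S) Φ dμ = Σ'_{b ∈ F} ∫ Φ dμ_b` for every complex `Φ ∈ 𝒮(𝔸_F^m)` (★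
`adelicSiegelCoeff_sdForm_eq_integral_chirp`) — the shape met after unfolding the Siegel–Eisenstein series over `F`.
[cite: Weil1965, Chap. IV n° 41, (34)–(35) p. 59] -/
theorem tsum_integral_chirp_smul_ratMatrix_eq_tsum_integral_fibre {Φ : (Fin m → AdeleRing (𝓞 F) F) → ℂ}
    (hΦ : Φ ∈ piSchwartzBruhat F (Fin m)) :
    ∑' ξ : F, ∫ x, chirp F (algebraMap F (AdeleRing (𝓞 F) F) ξ • ratMatrix F S) Φ x ∂μ =
      ∑' b : F, ∫ x, Φ x ∂(adelicSiegelFibreMeasure F (Fin m) μ (fun x => sdForm F (ratMatrix F S) x) hh hB b) := by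
  rw [← tsum_adelicSiegelCoeff_sdForm_eq_tsum_integral_fibre F μ hm hS hdet hh hB hΦ]
  exact tsum_congr fun ξ => (adelicSiegelCoeff_sdForm_eq_integral_chirp F μ S Φ ξ).symm

include hm hS hdet in
/-- **`HasSum` form landing in the Fourier side**: `Σ_b ∫ Φ dμ_b` converges to `Σ'_{ξ ∈ F} F*_Φ(ξ)` for every complex
`Φ ∈ 𝒮(𝔸_F^m)`. [cite: Weil1965, Chap. IV n° 41, (34)–(35) p. 59] -/
theorem hasSum_integral_adelicSiegelFibreMeasure_sdForm_tsum_adelicSiegelCoeff {Φ : (Fin m → AdeleRing (𝓞 F) F) → ℂ}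
    (hΦ : Φ ∈ piSchwartzBruhat F (Fin m)) :
    HasSum (fun b : F => ∫ x, Φ x ∂(adelicSiegelFibreMeasure F (Fin m) μ (fun x => sdForm F (ratMatrix F S) x) hh hB b))
      (∑' ξ : F, adelicSiegelCoeff F (Fin m) μ (fun x => sdForm F (ratMatrix F S) x) Φ ξ) := by
  rw [(tsum_adelicSiegelCoeff_sdForm_eq_integral F μ hm hS hdet hh hB hΦ).2]
  exact hasSum_integral_adelicSiegelFibreMeasure_sdForm F μ hm hS hdet hh hB hΦ

end Eisenstein

end Literature.NumberTheory.Weil1965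

end
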